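import Mathlib
import Literature.Analysis.FluidPDE.NSVorticityBKMHolds
import Literature.Analysis.FluidPDE.TaoLocalisationHolds
import Literature.Analysis.FluidPDE.TaoLocalisationProofs
import Summits.NavierStokesRegularity.NavierStokesRegularity.Theses.SlicedKelvin
import Summits.NavierStokesRegularity.NavierStokesRegularity.Theorems.LevelSetModerationHighSpeedPressureWorkSliceDecay

/-!
# Crux `SlicedKelvin.FluxZoom` (stmt-NavierStokesRegularity-15603), line `registered`,
# stub `stub_subslabBounds`: sup-form Beale–Kato–Majda and bounds on closed sub-slabs

Support file (theorems only, `--supports stmt-NavierStokesRegularity-15603`) for the lead's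
skeleton of the crux `FluxZoom` of route `SlicedKelvin`. For a classical solution `(u, p)` of
the unforced Navier–Stokes system (`ν > 0`) on `ℝ³ × [0, T)`, Leray–Hopf from its rapidly
decaying datum `u 0`:

* (a) if the vorticity `curl u` is bounded on `[0, T) × ℝ³`, the solution extends smoothly past
  `T` (sup-form of the Beale–Kato–Majda criterion);
* (b) on every closed sub-slab `[0, T'] × ℝ³`, `0 < T' < T`, velocity and vorticity are bounded.

## Proof

Verbatim the pattern of `Theorems/CoreLogGasCoreReductionContinuation.lean`, Steps 3–6.
By Tao 2013 (`tao2011_hasBoundedSobolevNormsOn_holds`, through the closed-slab corollary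
`tao2011_hasBoundedSobolevNormsOn.closedSlab` fed with the Leray–Hopf energy bound
`IsLerayHopfOn.lintegral_enorm_sq_le`; already landed in exactly this form as
`levelSetModeration_hasBoundedSobolevNormsOn_slab`, route LevelSetModeration, which is reused)
the solution lies in the BKM class `HasBoundedSobolevNormsOn (Icc 0 T₁) u` on every closed slab
`[0, T₁]`, `0 < T₁ < T`.
(b): the Sobolev imbedding `H² ⊂ L^∞` bounds the velocity
(`linfty_bound_of_hasBoundedSobolevNormsOn_holds`) and the vorticity
(`exists_enorm_curl_le_of_hasBoundedSobolevNormsOn`) on `[0, T'] × ℝ³`.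
(a): with `‖curl u‖ ≤ W` on `[0, T) × ℝ³` the BKM integral `∫₀ᵀ ‖curl u(t)‖_∞ dt ≤ W · T` is
finite, so the discharged criterion `beale_kato_majda_holds` continues the solution in the class
past `T`, in particular smoothly (`HasSobolevExtensionPast.hasSmoothExtensionPast`).

No named fact is assumed: every ingredient is a theorem of the tree.

## References

* J. T. Beale, T. Kato, A. Majda, Comm. Math. Phys. 94 (1984), Theorem 1 [BealeKatoMajda1984].
* T. Tao, Anal. PDE 6 (2013) = arXiv:1108.1165, Cor. 11.1 [Tao2011].
* R. A. Adams, *Sobolev Spaces* (1975), Thm. 5.4 Part I Case C [Adams1975].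
-/

noncomputable section

-- the summit and its single sub-problem share the name (CONVENTIONS §1), as in every Theorems file
set_option linter.dupNamespace false

open MeasureTheory Set Function Filter Topology
open scoped ENNReal NNReal ContDiff

namespace Summit.NavierStokesRegularity.NavierStokesRegularity.Theorems.FluxZoom.Registered

open Literature.Analysis.FluidPDE

/-- **Stub `stub_subslabBounds` of the crux `SlicedKelvin.FluxZoom`, line `registered`.** For a
classical solution of the unforced Navier–Stokes system (`ν > 0`) on `ℝ³ × [0, T)`, Leray–Hopf
from its rapidly decaying datum: (a) if its vorticity is bounded on `[0, T) × ℝ³` it extends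
smoothly past `T` (sup-form Beale–Kato–Majda: `beale_kato_majda_holds` with the BKM class on
closed sub-slabs from `tao2011_hasBoundedSobolevNormsOn_holds`); (b) on every closed sub-slab
`[0, T'] × ℝ³`, `0 < T' < T`, velocity and vorticity are bounded
(`linfty_bound_of_hasBoundedSobolevNormsOn_holds`,
`exists_enorm_curl_le_of_hasBoundedSobolevNormsOn`). Unconditional: no named fact is taken as
a hypothesis. -/
theorem stub_subslabBounds :
    ∀ (ν T : ℝ), 0 < ν → 0 < T →
      ∀ (u : ℝ → EuclideanSpace ℝ (Fin 3) → EuclideanSpace ℝ (Fin 3))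
        (p : ℝ → EuclideanSpace ℝ (Fin 3) → ℝ),
        Literature.Analysis.FluidPDE.IsClassicalNSSolutionOn (Set.Ico 0 T) ν 0 u p →
        Literature.Analysis.FluidPDE.IsLerayHopfOn T ν 0 (u 0) u →
        Literature.Analysis.FluidPDE.HasRapidSpatialDecay (u 0) →
        ((∃ W : ℝ, ∀ t ∈ Set.Ico 0 T, ∀ x, ‖Literature.Analysis.FluidPDE.curl (u t) x‖ ≤ W) →
            Literature.Analysis.FluidPDE.HasSmoothExtensionPast ν 0 u T) ∧
        (∀ T' ∈ Set.Ioo 0 T, ∃ B : ℝ, ∀ t ∈ Set.Icc 0 T', ∀ x,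
            ‖u t x‖ ≤ B ∧ ‖Literature.Analysis.FluidPDE.curl (u t) x‖ ≤ B) := by
  intro ν T hν hT u p hcl hLH hdec
  -- the BKM class on closed sub-slabs (Tao 2013, Cor. 11.1)
  have hslab : ∀ T₁ ∈ Ioo 0 T, HasBoundedSobolevNormsOn (Icc 0 T₁) u := fun T₁ hT₁ =>
    levelSetModeration_hasBoundedSobolevNormsOn_slab hν hcl hLH hdec hT₁
  refine ⟨?_, ?_⟩
  · -- (a) sup-form Beale–Kato–Majda
    rintro ⟨W, hW⟩
    have hreg : ∀ T'' < T, HasBoundedSobolevNormsOn (Icc 0 T'') u := by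
      intro T'' hT''
      have h1 : max T'' (T / 2) ∈ Ioo 0 T :=
        ⟨lt_max_of_lt_right (by linarith), max_lt hT'' (by linarith)⟩
      exact (hslab _ h1).mono (Icc_subset_Icc_right (le_max_left _ _))
    -- the BKM integral `∫₀ᵀ ‖curl u(t)‖_∞ dt ≤ W · T` is finite
    have hbound : ∀ t ∈ Ioo 0 T, (⨆ x, ‖curl (u t) x‖ₑ) ≤ ENNReal.ofReal W := by
      intro t ht
      refine iSup_le fun x => ?_
      calc ‖curl (u t) x‖ₑ = ENNReal.ofReal ‖curl (u t) x‖ := (ofReal_norm _).symm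
        _ ≤ ENNReal.ofReal W := ENNReal.ofReal_le_ofReal (hW t ⟨ht.1.le, ht.2⟩ x)
    have hfin : (∫⁻ t in Ioo 0 T, ⨆ x, ‖curl (u t) x‖ₑ) < ⊤ := by
      calc (∫⁻ t in Ioo 0 T, ⨆ x, ‖curl (u t) x‖ₑ)
          ≤ ∫⁻ _ in Ioo 0 T, ENNReal.ofReal W := setLIntegral_mono' measurableSet_Ioo hbound
        _ = ENNReal.ofReal W * volume (Ioo (0 : ℝ) T) := setLIntegral_const _ _
        _ < ⊤ := by
            refine ENNReal.mul_lt_top ENNReal.ofReal_lt_top ?_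
            rw [Real.volume_Ioo]
            exact ENNReal.ofReal_lt_top
    -- Beale–Kato–Majda continues the solution in the class, hence smoothly, past `T`
    exact ((beale_kato_majda_holds hν.le hT hcl hreg).2 hfin).hasSmoothExtensionPast
  · -- (b) velocity and vorticity bounded on `[0, T'] × ℝ³` (Sobolev imbedding `H² ⊂ L^∞`)
    intro T' hT'
    have hsm : ∀ t ∈ Icc 0 T', ContDiff ℝ ∞ (u t) := fun t ht =>
      hcl.contDiff_velocity ⟨ht.1, ht.2.trans_lt hT'.2⟩
    have hC2 : ∀ t ∈ Icc 0 T', ContDiff ℝ 2 (u t) := fun t ht =>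
      (hsm t ht).of_le (by norm_cast)
    obtain ⟨C, hC⟩ := linfty_bound_of_hasBoundedSobolevNormsOn_holds hC2 (hslab T' hT')
    obtain ⟨R, hR, hRb⟩ := exists_enorm_curl_le_of_hasBoundedSobolevNormsOn hsm (hslab T' hT')
    refine ⟨max C R.toReal, fun t ht x => ⟨(hC t ht x).trans (le_max_left _ _), ?_⟩⟩
    calc ‖curl (u t) x‖ = (‖curl (u t) x‖ₑ).toReal := (toReal_enorm _).symm
      _ ≤ R.toReal := ENNReal.toReal_mono hR.ne (hRb t ht x)
      _ ≤ max C R.toReal := le_max_right _ _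

end Summit.NavierStokesRegularity.NavierStokesRegularity.Theorems.FluxZoom.Registered

end
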